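import Mathlib
import HarnessLib
import Summits.HubbardSuperconductivity.HubbardSuperconductivity.Theorems.KLProgrammeKLRegimeEngineV8E5CarrierLines
import Summits.HubbardSuperconductivity.HubbardSuperconductivity.Theorems.KLProgrammeKLRegimeEngineTowerBlockIncrWt

/-!
# Route `KLProgramme` — ENGINE child gen 8 (stmt-HubbardSuperconductivity-20437 `KLRegimeEngineV17F2`), SKELETON v2 class #3, (RA-U) SUPPLIER part 3a:
# the carrier's COMPOSITION ALGEBRA, the input rows of `klE5Input`, PARITY (the odd half of (RA-U) discharged), and the four-term norm split
# (cell gate-hubbard-kl, seat p5 g11; pen (R71e)/(R71g); memo RA-U-SUPPLY §5–§6; form-agnostic w.r.t. E1's (RA-U-a′) word)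

The class-#3 open input (RA-U) of `exists_e5Pkg2_of_rows` (…E5WitnessRowsT) is a levelled law for the sectorised kernel norms of the Wick carrier
`W_Λ = klE5Carrier … κ V Λ = e^{Δ_{C∞ − C_Λ}}(effAction C_Λ V)` (…EngineV8E5Share), `V = klE5Input … (n−1)` (`𝒱_{n−1}[K_n]` minus its quadratic part),
plus the row «odd degrees `≤ 0`».  This file lands the pieces of the supplier that do NOT depend on the form of input (a) (E1's read-out, (RA-U-a′)):

* §1 the input: `kernel_klE5Input_two` (NO quadratic part), `kernel_klE5Input_of_ne_two` / `sectorisedKernel_klE5Input_of_ne_two` /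
  **`hubbardSectorKernelNorm_klE5Input_of_ne_two`** (every other degree of `V` IS that of `𝒱_{n₀}[K]`, in any family, any tuple set — so input (a) is
  literally a read-out of `𝒱_{n−1}[K_n]`), `hubbardSectorKernelNorm_klE5Input_two` (`= 0`), `klE5Input_mem_evenPart`, `constPart_klE5Input_eq_zero` (`Z ≠ 0`);
* §2 **`klE5Carrier_eq_gaussConv_total_add`** — `W_Λ = e^{Δ_{C∞}} V + e^{Δ_{C∞ − C_Λ}} (effAction C_Λ V − e^{Δ_{C_Λ}} V)` (Laplacians add: `gaussConv_add_apply`),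
  for ANY dressing `κ` and input `V`;
* §3 parity: `klE5Carrier_mem_evenPart` (even constant-free input ⇒ even carrier), `hubbardSectorKernelNorm_klE5Carrier_eq_zero_of_not_even`, and the
  (R1′) specialisations **`klE5Carrier_odd_le_zero_pointAugment`** / **`klE5Carrier_odd_le_zero_trivial`** = the «odd `≤ 0`» rows of `h3` / `h12r` in
  `exists_e5Pkg2_of_rows` VERBATIM, at every `n`, `Λ`, `Qm`, `x`, `y` (hypotheses: `β ≠ 0` and `Z^{K_n}_{Λ_{n−1}} ≠ 0`);
* §4 **`hubbardSectorKernelNorm_klE5Carrier_le_four`** — `‖W_Λ‖_{F,A} ≤ ‖V‖_{F,A} + ‖e^{Δ_{C∞}}V − V‖_{F,A} + ‖I_Λ‖_{F,A} + ‖e^{Δ_D} I_Λ − I_Λ‖_{F,A}`,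
  `I_Λ := effAction C_Λ V − e^{Δ_{C_Λ}} V`, `D := C∞ − C_Λ`, in ANY family `F` and tuple set `A` — the norm skeleton of parts 3b/4 (term 1 = input (a) read
  at the output family; terms 2 and 4 = the binomial door `carrierStep_firstOrder_lev_le` with `C∞` resp. `D`; term 3 = the graded door
  `carrierStep_ordersGe2_lev_le` with `C_Λ`, …E5CarrierBlockStep).
Pure composition of landed theorems; no definitions, no named facts, nothing about the model's sizes is asserted; nothing asserts superconductivity.
-/

noncomputable section

namespace Summit.HubbardSuperconductivity.HubbardSuperconductivity.Theorems.KLRegimeSplit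

set_option linter.dupNamespace false -- summit = problem name (single-conjunct summit), D-0017

open Real Finset Literature.MathematicalPhysics.QuantumLattice Literature.Probability.LatticeModels GrassmannAlgebra Matrix
open Literature.MathematicalPhysics.QuantumLattice.FermiRG
open Summit.HubbardSuperconductivity.HubbardSuperconductivity.Theorems.KLProgrammeLegKernels
open Summit.HubbardSuperconductivity.HubbardSuperconductivity.Theorems.KLRegimeWick
open Summit.HubbardSuperconductivity.HubbardSuperconductivity.Theorems.EngineV8
open Summit.HubbardSuperconductivity.HubbardSuperconductivity.Theorems.TwoPointAssembly
open Summit.HubbardSuperconductivity.HubbardSuperconductivity.Theorems.TorusFourierL2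
open Summit.HubbardSuperconductivity.HubbardSuperconductivity.Theorems.DispersionFlow

/-! ## §1 The input `V = 𝒱_{n₀}[K] − presented (kernel 𝒱_{n₀}[K] 2)`: kernels, sectorised norms, parity, constant part -/

section Input

variable {L M : ℕ} [NeZero L] (β U μ : ℝ) (K : TrigPolyC4v) (n₀ : ℕ)

/-- **`V` has NO quadratic part**: `kernel V 2 = 0` (`kernel_presented_kernel`). [folklore] -/
theorem kernel_klE5Input_two (X : Fin 2 → HubbardFieldIdx L M) : kernel ℂ (klE5Input L M β U μ K n₀) 2 X = 0 := by
  unfold klE5Input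
  rw [kernel_sub', Literature.MathematicalPhysics.QuantumLattice.kernel_presented_kernel, sub_self]

/-- **Every other degree of `V` is that of `𝒱_{n₀}[K]`** (`kernel_presented_of_ne`). [folklore] -/
theorem kernel_klE5Input_of_ne_two {m : ℕ} (hm : m ≠ 2) (X : Fin m → HubbardFieldIdx L M) :
    kernel ℂ (klE5Input L M β U μ K n₀) m X = kernel ℂ (klEffectiveAction L M β U μ K klE0 n₀) m X := by
  unfold klE5Input
  rw [kernel_sub', kernel_presented_of_ne ℂ _ X hm, sub_zero]

/-- The sectorised kernels of `V` at degree `m ≠ 2` are those of `𝒱_{n₀}[K]`, in ANY family. [folklore] -/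
theorem sectorisedKernel_klE5Input_of_ne_two {N : ℕ} (F : Fin N → FreqMomentum L M → ℂ) {m : ℕ} (hm : m ≠ 2) :
    sectorisedKernel L M β F (klE5Input L M β U μ K n₀) m = sectorisedKernel L M β F (klEffectiveAction L M β U μ K klE0 n₀) m := by
  funext Ω x
  simp only [sectorisedKernel_def, kernel_klE5Input_of_ne_two β U μ K n₀ hm]

/-- The sectorised kernels of `V` at degree `2` vanish, in ANY family. [folklore] -/
theorem sectorisedKernel_klE5Input_two {N : ℕ} (F : Fin N → FreqMomentum L M → ℂ) :
    sectorisedKernel L M β F (klE5Input L M β U μ K n₀) 2 = 0 := by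
  funext Ω x
  simp only [sectorisedKernel_def, kernel_klE5Input_two β U μ K n₀, mul_zero, sum_const_zero, Pi.zero_apply]

/-- **Input (a) is a read-out of `𝒱_{n₀}[K]`**: at every degree `m ≠ 2`, in ANY family `F` and for ANY tuple set `A` (e.g. `prescribedTuples univ Ωe` at a
point-augmented family), `‖V‖_{F,A,m} = ‖𝒱_{n₀}[K]‖_{F,A,m}`. [folklore] -/
theorem hubbardSectorKernelNorm_klE5Input_of_ne_two {N : ℕ} (F : Fin N → FreqMomentum L M → ℂ) {m : ℕ} (hm : m ≠ 2) (A : Finset (Fin m → SectorLeg N)) :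
    hubbardSectorKernelNorm L M β F A (klE5Input L M β U μ K n₀) = hubbardSectorKernelNorm L M β F A (klEffectiveAction L M β U μ K klE0 n₀) := by
  rw [hubbardSectorKernelNorm, hubbardSectorKernelNorm, sectorisedKernel_klE5Input_of_ne_two β U μ K n₀ F hm]

/-- … and at degree `2` it is `0`. [folklore] -/
theorem hubbardSectorKernelNorm_klE5Input_two {N : ℕ} (F : Fin N → FreqMomentum L M → ℂ) (A : Finset (Fin 2 → SectorLeg N)) :
    hubbardSectorKernelNorm L M β F A (klE5Input L M β U μ K n₀) = 0 := by
  rw [hubbardSectorKernelNorm, sectorisedKernel_klE5Input_two β U μ K n₀ F]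
  exact sectorisedKernelNorm_zero_kernel _ _ _

/-- **`V` is even** (`β ≠ 0`): `𝒱_{n₀}[K]` is even (`klEffectiveAction_mem_evenPart`) and a presented degree-`2` kernel is even. [folklore] -/
theorem klE5Input_mem_evenPart [NeZero M] (hβ : β ≠ 0) : klE5Input L M β U μ K n₀ ∈ evenPart ℂ (HubbardFieldIdx L M) := by
  unfold klE5Input
  refine sub_mem (klEffectiveAction_mem_evenPart hβ U μ K klE0 n₀) ?_
  rw [presented]
  refine Subalgebra.sum_mem _ fun Y _ => Subalgebra.smul_mem _ (mem_evenPart_iff.2 ?_) _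
  have h2 : ((2 : ℕ) : ZMod 2) = 0 := by decide
  simpa only [h2] using genProd_mem_evenOdd ℂ Y

/-- **`V` has no constant part** when the partition function of the step's input is nonzero (`Z^K_{Λ_{n₀}} ≠ 0`). [folklore] -/
theorem constPart_klE5Input_eq_zero (hZ : hubbardEffPartitionFnCT L M β U μ 0 K (klScale klE0 n₀) ≠ 0) :
    constPart ℂ (klE5Input L M β U μ K n₀) = 0 := by
  unfold klE5Input
  rw [map_sub, constPart_klEffectiveAction_eq_zero β U μ K klE0 n₀ hZ, constPart_presented_two, sub_zero]

end Input

/-! ## §2 The composition algebra of the carrier -/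

section Algebra

variable {L M : ℕ} [NeZero L] (β μ : ℝ) (K : TrigPolyC4v) (n₀ : ℕ) (κ : FreqMomentum L M × Fin 2 → ℂ)

/-- **`W_Λ = e^{Δ_{C∞}} V + e^{Δ_{C∞ − C_Λ}} (effAction C_Λ V − e^{Δ_{C_Λ}} V)`** — the carrier is the input smeared by the TOTAL covariance plus the
orders-≥-2 increment of the dressed partial slice smeared by the dressed soft line `D = C∞ − C_Λ` (`gaussConv_add_apply`: `e^{Δ_D} e^{Δ_{C_Λ}} = e^{Δ_{C∞}}`).
Any dressing `κ`, any input `V`. [cite: BenfattoGiulianiMastropietro2006, §3 (3.2)-(3.8)] -/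
theorem klE5Carrier_eq_gaussConv_total_add (V : HubbardGrassmann L M) (Λ : ℝ) :
    klE5Carrier L M β μ K n₀ κ V Λ =
      gaussConv ℂ (klE5Total L M β μ K n₀ κ) V +
        gaussConv ℂ (klE5Total L M β μ K n₀ κ - klE5DressedSlice L M β μ K n₀ κ Λ)
          (effAction ℂ (klE5DressedSlice L M β μ K n₀ κ Λ) V - gaussConv ℂ (klE5DressedSlice L M β μ K n₀ κ Λ) V) := by
  unfold klE5Carrier
  rw [map_sub, ← gaussConv_add_apply, sub_add_cancel]
  abel

end Algebra

/-! ## §3 Parity of the carrier; the odd half of (RA-U) -/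

section Parity

variable {L M : ℕ} [NeZero L] (β μ : ℝ) (K : TrigPolyC4v) (n₀ : ℕ) (κ : FreqMomentum L M × Fin 2 → ℂ)

/-- **The carrier of an even, constant-free input is even** (any dressing `κ`, any cutoff `Λ`): `effAction` and `gaussConv` preserve parity. [folklore] -/
theorem klE5Carrier_mem_evenPart {V : HubbardGrassmann L M} (hV : V ∈ evenPart ℂ (HubbardFieldIdx L M)) (hV0 : constPart ℂ V = 0) (Λ : ℝ) :
    klE5Carrier L M β μ K n₀ κ V Λ ∈ evenPart ℂ (HubbardFieldIdx L M) := by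
  unfold klE5Carrier
  exact mem_evenPart_iff.2 (gaussConv_mem_evenOdd ℂ _ (mem_evenPart_iff.1 (effAction_mem_evenPart _ hV hV0)))

/-- **Odd degrees of the carrier carry nothing**, in ANY family and for ANY tuple set. [folklore] -/
theorem hubbardSectorKernelNorm_klE5Carrier_eq_zero_of_not_even {V : HubbardGrassmann L M} (hV : V ∈ evenPart ℂ (HubbardFieldIdx L M))
    (hV0 : constPart ℂ V = 0) (Λ : ℝ) {N : ℕ} (F : Fin N → FreqMomentum L M → ℂ) {m : ℕ} (hm : ¬ Even m) (A : Finset (Fin m → SectorLeg N)) :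
    hubbardSectorKernelNorm L M β F A (klE5Carrier L M β μ K n₀ κ V Λ) = 0 :=
  hubbardSectorKernelNorm_eq_zero_of_evenOdd_zero_of_not_even β F (mem_evenPart_iff.1 (klE5Carrier_mem_evenPart β μ K n₀ κ hV hV0 Λ)) hm A

variable (U : ℝ)

/-- **The «odd `≤ 0`» row of (RA-U) (`h3` of `exists_e5Pkg2_of_rows`), DISCHARGED** at every step `n`, cutoff `Λ`, total momentum `Qm` and labels `x, y`:
the (R1′) carrier at the frame `K_n` in the point-augmented anisotropic family of level `n−2` has vanishing odd prescribed norms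
(`β ≠ 0`, `Z^{K_n}_{Λ_{n−1}} ≠ 0`). [folklore] -/
theorem klE5Carrier_odd_le_zero_pointAugment [NeZero M] (hβ : β ≠ 0) (n : ℕ)
    (hZ : hubbardEffPartitionFnCT L M β U μ 0 (klFlowFrameU L M β U μ n) (klScale klE0 (n - 1)) ≠ 0)
    (Λ : ℝ) (Qm : TorusSite 2 L) (x y : TorusSite 2 L × MatsubaraIdx M) :
    ∀ m : ℕ, ¬ Even m → ∀ Ωe : Fin m → Option (SectorLeg (sectorCount (n - 2) + 4)),
      hubbardSectorKernelNorm L M β (pointAugment (klAnisoFamily L M β μ (klFlowFrameU L M β U μ n) klE0 (n - 2)) (klE5ExtMomenta Qm x y))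
        (prescribedTuples univ Ωe)
        (klE5Carrier L M β μ (klFlowFrameU L M β U μ n) (n - 1) (klE5Kappa L M β U μ (klFlowFrameU L M β U μ n) (n - 1))
          (klE5Input L M β U μ (klFlowFrameU L M β U μ n) (n - 1)) Λ) ≤ 0 :=
  fun _ hm Ωe => (hubbardSectorKernelNorm_klE5Carrier_eq_zero_of_not_even β μ _ (n - 1) _
    (klE5Input_mem_evenPart β U μ _ (n - 1) hβ) (constPart_klE5Input_eq_zero β U μ _ (n - 1) hZ) Λ _ hm (prescribedTuples univ Ωe)).le

/-- **The «odd `≤ 0`» row of (RA-U)₀ (`h12r` of `exists_e5Pkg2_of_rows`, the first steps' trivial family), DISCHARGED** likewise. [folklore] -/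
theorem klE5Carrier_odd_le_zero_trivial [NeZero M] (hβ : β ≠ 0) (n : ℕ)
    (hZ : hubbardEffPartitionFnCT L M β U μ 0 (klFlowFrameU L M β U μ n) (klScale klE0 (n - 1)) ≠ 0) (Λ : ℝ) :
    ∀ m : ℕ, ¬ Even m → ∀ Ωe : Fin m → Option (SectorLeg 1),
      hubbardSectorKernelNorm L M β (trivialMultiplier L M) (prescribedTuples univ Ωe)
        (klE5Carrier L M β μ (klFlowFrameU L M β U μ n) (n - 1) (klE5Kappa L M β U μ (klFlowFrameU L M β U μ n) (n - 1))
          (klE5Input L M β U μ (klFlowFrameU L M β U μ n) (n - 1)) Λ) ≤ 0 :=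
  fun _ hm Ωe => (hubbardSectorKernelNorm_klE5Carrier_eq_zero_of_not_even β μ _ (n - 1) _
    (klE5Input_mem_evenPart β U μ _ (n - 1) hβ) (constPart_klE5Input_eq_zero β U μ _ (n - 1) hZ) Λ _ hm (prescribedTuples univ Ωe)).le

end Parity

/-! ## §4 The four-term norm split of the carrier (the skeleton of parts 3b/4) -/

section Split

variable {L M : ℕ} [NeZero L] {β : ℝ} (hβ : 0 ≤ β) (μ : ℝ) (K : TrigPolyC4v) (n₀ : ℕ) (κ : FreqMomentum L M × Fin 2 → ℂ)
include hβ

/-- **`‖W_Λ‖ ≤ ‖V‖ + ‖e^{Δ_{C∞}}V − V‖ + ‖I_Λ‖ + ‖e^{Δ_D}I_Λ − I_Λ‖`** in ANY family `F` and for ANY tuple set `A` of one degree, where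
`I_Λ = effAction C_Λ V − e^{Δ_{C_Λ}}V` (orders ≥ 2 of the dressed partial slice's step) and `D = C∞ − C_Λ` (the dressed soft line): §2 and subadditivity.
Term 1 is input (a) read at the output family; terms 2/4 are first-order (binomial) doors with `C∞`/`D`; term 3 is the graded door with `C_Λ`
(…E5CarrierBlockStep §2/§3). [cite: BenfattoGiulianiMastropietro2006, §2.8 (2.80)-(2.84)] -/
theorem hubbardSectorKernelNorm_klE5Carrier_le_four (V : HubbardGrassmann L M) (Λ : ℝ) {N : ℕ} (F : Fin N → FreqMomentum L M → ℂ) {m : ℕ}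
    (A : Finset (Fin m → SectorLeg N)) :
    hubbardSectorKernelNorm L M β F A (klE5Carrier L M β μ K n₀ κ V Λ) ≤
      hubbardSectorKernelNorm L M β F A V +
        hubbardSectorKernelNorm L M β F A (gaussConv ℂ (klE5Total L M β μ K n₀ κ) V - V) +
        hubbardSectorKernelNorm L M β F A
          (effAction ℂ (klE5DressedSlice L M β μ K n₀ κ Λ) V - gaussConv ℂ (klE5DressedSlice L M β μ K n₀ κ Λ) V) +
        hubbardSectorKernelNorm L M β F A
          (gaussConv ℂ (klE5Total L M β μ K n₀ κ - klE5DressedSlice L M β μ K n₀ κ Λ)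
              (effAction ℂ (klE5DressedSlice L M β μ K n₀ κ Λ) V - gaussConv ℂ (klE5DressedSlice L M β μ K n₀ κ Λ) V) -
            (effAction ℂ (klE5DressedSlice L M β μ K n₀ κ Λ) V - gaussConv ℂ (klE5DressedSlice L M β μ K n₀ κ Λ) V)) := by
  set I := effAction ℂ (klE5DressedSlice L M β μ K n₀ κ Λ) V - gaussConv ℂ (klE5DressedSlice L M β μ K n₀ κ Λ) V with hI
  set D := klE5Total L M β μ K n₀ κ - klE5DressedSlice L M β μ K n₀ κ Λ with hD
  set A₁ := gaussConv ℂ (klE5Total L M β μ K n₀ κ) V - V with hA₁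
  set B₁ := gaussConv ℂ D I - I with hB₁
  have hW : klE5Carrier L M β μ K n₀ κ V Λ = (V + A₁) + (I + B₁) := by
    rw [klE5Carrier_eq_gaussConv_total_add β μ K n₀ κ V Λ, hA₁, hB₁]
    abel
  rw [hW]
  calc hubbardSectorKernelNorm L M β F A ((V + A₁) + (I + B₁))
      ≤ hubbardSectorKernelNorm L M β F A (V + A₁) + hubbardSectorKernelNorm L M β F A (I + B₁) := hubbardSectorKernelNorm_add_le hβ F A _ _
    _ ≤ (hubbardSectorKernelNorm L M β F A V + hubbardSectorKernelNorm L M β F A A₁) +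
          (hubbardSectorKernelNorm L M β F A I + hubbardSectorKernelNorm L M β F A B₁) :=
        add_le_add (hubbardSectorKernelNorm_add_le hβ F A _ _) (hubbardSectorKernelNorm_add_le hβ F A _ _)
    _ = _ := by ring

end Split

end Summit.HubbardSuperconductivity.HubbardSuperconductivity.Theorems.KLRegimeSplit

end
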